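import Mathlib
import HarnessLib
import Summits.Ventures.LatticeQCDFlow.Exactness.GaugeFTHMCCreutz
import Summits.Ventures.LatticeQCDFlow.Exactness.SU2WilsonFlowLOMember

/-!
# `⟨ΔH̃⟩ ≥ 0` for field-transformed gauge HMC (Jensen's companion of Creutz's identity), on the engine's rungs

HONEST FRAMING: exact (Metropolis-corrected) sampling algorithms for lattice gauge theory;
figures of merit are autocorrelation/cost numbers at stated couplings and volumes; no
continuum-physics claim.

Venture `LatticeQCDFlow` (cell pub-lqcd), topic `Exactness`; FANOUT row 14 (`eng-flowhmc`, engine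
`latflow.fthmc`, family B).  NEW WORK of the cell; no number.  `GaugeFTHMCCreutz.lean` proved the
row's acceptance identity `⟨e^{−ΔH̃}⟩ = 1` for the exact FT-HMC kernel in equilibrium (Literature
`HMC.integral_exp_neg_deltaH` [MontvayMunster1994 §7.6]); its Jensen companion
`⟨ΔH̃⟩ ≥ 0` (Literature `HMC.integral_deltaH_nonneg`, same source — imported by name, not restated)
is the second routine consistency check of an HMC implementation (the mean energy violation of a
reversible area-preserving integrator started in equilibrium is non-negative).  This file
discharges its hypotheses for the engine's kernels:

* `integrable_exp_neg_ftHamiltonian` — `e^{−H̃}`, `H̃ = (S∘F − log J) + T`, is integrable on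
  `μ ⊗ ν` for every certified `(F, J)` as soon as `e^{−S}` and `e^{−T}` are (the transformation
  does not change the extended partition function: `lintegral_exp_neg_ftHamiltonian`);
* **`gauge_fthmc_leapfrog_deltaH_nonneg`** — gauge-link FT-HMC (any group, left-invariant `μ`,
  group drift, ANY measurable force, any trajectory length, any certified `(F, J)`): if `ΔH̃` is
  integrable in equilibrium then `0 ≤ ⟨ΔH̃⟩`;
* **`gauge_fthmc_leapfrog_gaussian_deltaH_nonneg`** — the engine's rungs (probability Haar links,
  Gaussian momenta `κ → ℝ`);
* **`su2_fthmc_leapfrog_gaussian_deltaH_nonneg`** — the `SU(2)` rung with the quaternion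
  exponential drift, through ANY certified layer (LO Wilson-flow member, learned residual layers,
  schedules).

NOT CLAIMED: integrability of `ΔH̃` itself (a hypothesis: it holds e.g. for bounded actions, not
discussed); the Gaussian/erfc model of the acceptance rate; any number.
-/

noncomputable section

namespace Summit.Ventures.LatticeQCDFlow.Exactness

open Real Set MeasureTheory Measure WithLp
open Literature.Probability.MarkovChains.HMC (partitionFn boltzmann integral_deltaH_nonneg)
open Literature.MathematicalPhysics.QuantumFieldTheory
open scoped ENNReal

/-! ## Integrability of `e^{−H̃}` -/

section General

variable {Q P : Type*} [MeasurableSpace Q] [MeasurableSpace P]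

/-- **`e^{−H̃}` is integrable** on `μ ⊗ ν` for the pulled-back Hamiltonian
`H̃ (v, p) = (S (F v) − log J v) + T p` of any certified `(F, J)`, given that `e^{−S}` is
`μ`-integrable and `e^{−T}` is `ν`-integrable. -/
theorem integrable_exp_neg_ftHamiltonian {μ : Measure Q} [SFinite μ] {ν : Measure P} [SFinite ν]
    {F : Q → Q} {J : Q → ℝ} (hJ : ∀ v, 0 < J v) (hJm : Measurable J)
    (hF : HasJacobian μ F fun v => ENNReal.ofReal (J v))
    {S : Q → ℝ} (hS : Measurable S) {T : P → ℝ} (hT : Measurable T)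
    (hSi : Integrable (fun v => Real.exp (-S v)) μ) (hTi : Integrable (fun p => Real.exp (-T p)) ν) :
    Integrable (fun z : Q × P => Real.exp (-((S (F z.1) - Real.log (J z.1)) + T z.2))) (μ.prod ν) := by
  have hm : Measurable fun z : Q × P => Real.exp (-((S (F z.1) - Real.log (J z.1)) + T z.2)) :=
    Real.measurable_exp.comp (measurable_ftHamiltonian hS hT hF.measurable hJm).neg
  have hprod : Integrable (fun z : Q × P => Real.exp (-(S z.1 + T z.2))) (μ.prod ν) := by
    refine (hSi.mul_prod hTi).congr (ae_of_all _ fun z => ?_)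
    simp only
    rw [neg_add, Real.exp_add]
  refine ⟨hm.aestronglyMeasurable,
    (hasFiniteIntegral_iff_ofReal (ae_of_all _ fun z => (Real.exp_pos _).le)).2 ?_⟩
  rw [lintegral_exp_neg_ftHamiltonian hJ hJm hF hS hT]
  exact (hasFiniteIntegral_iff_ofReal (ae_of_all _ fun z => (Real.exp_pos _).le)).1
    hprod.hasFiniteIntegral

/-- **`⟨ΔH̃⟩ ≥ 0` for field-transformed gauge HMC.**  Links in a measurable group `Q` with
left-invariant s-finite non-zero `μ`, momenta in `P` with reflection- and translation-invariant
s-finite non-zero `ν`; certified `(F, J)`; measurable drift `e`, ANY measurable force `g`, any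
`n`; measurable `S`, `T` with `e^{−S}`, `e^{−T}` integrable.  If the energy violation
`ΔH̃ = H̃ ∘ Ψ − H̃` of the proposal `Ψ = flip ∘ leapfrog^n` is integrable in `H̃`-equilibrium, its
mean is non-negative (Jensen + Creutz). -/
theorem gauge_fthmc_leapfrog_deltaH_nonneg [Group Q] [MeasurableMul₂ Q] {μ : Measure Q}
    [μ.IsMulLeftInvariant] [SFinite μ] [NeZero μ] [AddCommGroup P] [MeasurableNeg P]
    [MeasurableAdd₂ P] {ν : Measure P} [ν.IsNegInvariant] [ν.IsAddRightInvariant] [SFinite ν]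
    [NeZero ν] {F : Q → Q} {J : Q → ℝ} (hJ : ∀ v, 0 < J v) (hJm : Measurable J)
    (hF : HasJacobian μ F fun v => ENNReal.ofReal (J v))
    {e : P → Q} (hem : Measurable e) {g : Q → P} (hg : Measurable g) (n : ℕ)
    {S : Q → ℝ} (hS : Measurable S) {T : P → ℝ} (hT : Measurable T)
    (hSi : Integrable (fun v => Real.exp (-S v)) μ) (hTi : Integrable (fun p => Real.exp (-T p)) ν)
    (hδ : Integrable (fun z : Q × P =>
        ((S (F (((flip : Equiv.Perm (Q × P)) * leapfrog (mulDrift e) g ^ n) z).1) -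
            Real.log (J (((flip : Equiv.Perm (Q × P)) * leapfrog (mulDrift e) g ^ n) z).1)) +
            T (((flip : Equiv.Perm (Q × P)) * leapfrog (mulDrift e) g ^ n) z).2) -
          ((S (F z.1) - Real.log (J z.1)) + T z.2))
      (boltzmann (μ.prod ν) fun z : Q × P => (S (F z.1) - Real.log (J z.1)) + T z.2)) :
    0 ≤ ∫ z, (((S (F (((flip : Equiv.Perm (Q × P)) * leapfrog (mulDrift e) g ^ n) z).1) -
            Real.log (J (((flip : Equiv.Perm (Q × P)) * leapfrog (mulDrift e) g ^ n) z).1)) +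
            T (((flip : Equiv.Perm (Q × P)) * leapfrog (mulDrift e) g ^ n) z).2) -
          ((S (F z.1) - Real.log (J z.1)) + T z.2))
      ∂(boltzmann (μ.prod ν) fun z : Q × P => (S (F z.1) - Real.log (J z.1)) + T z.2) := by
  have hZ' : 0 < partitionFn (μ.prod ν)
      (fun z : Q × P => (S (F z.1) - Real.log (J z.1)) + T z.2) := by
    rw [fthmc_partitionFn_eq hJ hJm hF hS hT]
    exact partitionFn_prod_pos hSi hTi
  exact integral_deltaH_nonneg (H := fun z : Q × P => (S (F z.1) - Real.log (J z.1)) + T z.2)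
    (measurePreserving_gaugeLeapfrogProposal hem hg n)
    (measurable_ftHamiltonian hS hT hF.measurable hJm)
    (integrable_exp_neg_ftHamiltonian hJ hJm hF hS hT hSi hTi) hZ' hδ

end General

/-! ## The engine's rungs: probability Haar links, Gaussian momenta -/

section Gaussian

variable {Q : Type*} [MeasurableSpace Q] {κ : Type*} [Fintype κ]

/-- **`⟨ΔH̃⟩ ≥ 0` on the engine's rungs.**  Links with a left-invariant PROBABILITY measure `μ`,
momenta `κ → ℝ` with Lebesgue measure and `T = Σ p²/2`, any measurable drift and force, any `n`,
`e^{−S}` integrable, any certified `(F, J)`: if `ΔH̃` is integrable in equilibrium then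
`0 ≤ ⟨ΔH̃⟩`. -/
theorem gauge_fthmc_leapfrog_gaussian_deltaH_nonneg [Group Q] [MeasurableMul₂ Q] {μ : Measure Q}
    [μ.IsMulLeftInvariant] [IsProbabilityMeasure μ]
    {F : Q → Q} {J : Q → ℝ} (hJ : ∀ v, 0 < J v) (hJm : Measurable J)
    (hF : HasJacobian μ F fun v => ENNReal.ofReal (J v))
    {e : (κ → ℝ) → Q} (hem : Measurable e) {g : Q → (κ → ℝ)} (hg : Measurable g) (n : ℕ)
    {S : Q → ℝ} (hS : Measurable S) (hSi : Integrable (fun v => Real.exp (-S v)) μ)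
    (hδ : Integrable (fun z : Q × (κ → ℝ) =>
        ((S (F (((flip : Equiv.Perm (Q × (κ → ℝ))) * leapfrog (mulDrift e) g ^ n) z).1) -
            Real.log (J (((flip : Equiv.Perm (Q × (κ → ℝ))) * leapfrog (mulDrift e) g ^ n) z).1)) +
            ∑ i, (((flip : Equiv.Perm (Q × (κ → ℝ))) * leapfrog (mulDrift e) g ^ n) z).2 i ^ 2 / 2) -
          ((S (F z.1) - Real.log (J z.1)) + ∑ i, z.2 i ^ 2 / 2))
      (boltzmann (μ.prod (volume : Measure (κ → ℝ)))
        fun z : Q × (κ → ℝ) => (S (F z.1) - Real.log (J z.1)) + ∑ i, z.2 i ^ 2 / 2)) :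
    0 ≤ ∫ z, (((S (F (((flip : Equiv.Perm (Q × (κ → ℝ))) * leapfrog (mulDrift e) g ^ n) z).1) -
            Real.log (J (((flip : Equiv.Perm (Q × (κ → ℝ))) * leapfrog (mulDrift e) g ^ n) z).1)) +
            ∑ i, (((flip : Equiv.Perm (Q × (κ → ℝ))) * leapfrog (mulDrift e) g ^ n) z).2 i ^ 2 / 2) -
          ((S (F z.1) - Real.log (J z.1)) + ∑ i, z.2 i ^ 2 / 2))
      ∂(boltzmann (μ.prod (volume : Measure (κ → ℝ)))
          fun z : Q × (κ → ℝ) => (S (F z.1) - Real.log (J z.1)) + ∑ i, z.2 i ^ 2 / 2) := by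
  haveI := isNegInvariant_volume_pi (Λ := κ)
  haveI := neZero_volume_pi (κ := κ)
  exact gauge_fthmc_leapfrog_deltaH_nonneg (ν := (volume : Measure (κ → ℝ)))
    (T := fun p : κ → ℝ => ∑ i, p i ^ 2 / 2) hJ hJm hF hem hg n hS measurable_piGaussianKinetic
    hSi integrable_exp_neg_piGaussianKinetic hδ

end Gaussian

/-! ## The `SU(2)` rung -/

section SU2

variable {d L : ℕ} [NeZero L]

/-- **`⟨ΔH̃⟩ ≥ 0` for FT-HMC on the `SU(2)` rung as the engine runs it** (product Haar links,
momenta `(Edge × Fin 3) → ℝ`, the quaternion exponential drift, ANY force, any `n`, `e^{−S}`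
integrable, ANY certified layer `(F, J)` — the LO Wilson-flow member, a learned residual layer, a
schedule of either): if `ΔH̃` is integrable in equilibrium, `0 ≤ ⟨ΔH̃⟩`. -/
theorem su2_fthmc_leapfrog_gaussian_deltaH_nonneg
    {F : GaugeConfig d L (Matrix.specialUnitaryGroup (Fin 2) ℂ) → GaugeConfig d L (Matrix.specialUnitaryGroup (Fin 2) ℂ)} {J : GaugeConfig d L (Matrix.specialUnitaryGroup (Fin 2) ℂ) → ℝ} (hJ : ∀ V, 0 < J V)
    (hJm : Measurable J)
    (hF : HasJacobian (Measure.pi fun _ : Edge d L => haarProbability (Matrix.specialUnitaryGroup (Fin 2) ℂ)) F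
      fun V => ENNReal.ofReal (J V))
    {S : GaugeConfig d L (Matrix.specialUnitaryGroup (Fin 2) ℂ) → ℝ} (hS : Measurable S)
    (hSi : Integrable (fun V => Real.exp (-S V))
      (Measure.pi fun _ : Edge d L => haarProbability (Matrix.specialUnitaryGroup (Fin 2) ℂ)))
    (c : ℝ) {g : GaugeConfig d L (Matrix.specialUnitaryGroup (Fin 2) ℂ) → ((Edge d L × Fin 3) → ℝ)} (hg : Measurable g) (n : ℕ)
    (hδ : Integrable (fun z : GaugeConfig d L (Matrix.specialUnitaryGroup (Fin 2) ℂ) × ((Edge d L × Fin 3) → ℝ) =>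
        ((S (F ((((flip : Equiv.Perm (GaugeConfig d L (Matrix.specialUnitaryGroup (Fin 2) ℂ) × ((Edge d L × Fin 3) → ℝ))) *
              leapfrog (mulDrift (fun p : (Edge d L × Fin 3) → ℝ => fun ℓ : Edge d L => gaussUnit (toLp 2
          ![Real.cos (c * Real.sqrt (p (ℓ, 0) ^ 2 + p (ℓ, 1) ^ 2 + p (ℓ, 2) ^ 2)),
            c * Real.sinc (c * Real.sqrt (p (ℓ, 0) ^ 2 + p (ℓ, 1) ^ 2 + p (ℓ, 2) ^ 2)) * p (ℓ, 0),
            c * Real.sinc (c * Real.sqrt (p (ℓ, 0) ^ 2 + p (ℓ, 1) ^ 2 + p (ℓ, 2) ^ 2)) * p (ℓ, 1),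
            c * Real.sinc (c * Real.sqrt (p (ℓ, 0) ^ 2 + p (ℓ, 1) ^ 2 + p (ℓ, 2) ^ 2)) * p (ℓ, 2)]))) g ^ n)) z).1) -
            Real.log (J ((((flip : Equiv.Perm (GaugeConfig d L (Matrix.specialUnitaryGroup (Fin 2) ℂ) × ((Edge d L × Fin 3) → ℝ))) *
              leapfrog (mulDrift (fun p : (Edge d L × Fin 3) → ℝ => fun ℓ : Edge d L => gaussUnit (toLp 2
          ![Real.cos (c * Real.sqrt (p (ℓ, 0) ^ 2 + p (ℓ, 1) ^ 2 + p (ℓ, 2) ^ 2)),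
            c * Real.sinc (c * Real.sqrt (p (ℓ, 0) ^ 2 + p (ℓ, 1) ^ 2 + p (ℓ, 2) ^ 2)) * p (ℓ, 0),
            c * Real.sinc (c * Real.sqrt (p (ℓ, 0) ^ 2 + p (ℓ, 1) ^ 2 + p (ℓ, 2) ^ 2)) * p (ℓ, 1),
            c * Real.sinc (c * Real.sqrt (p (ℓ, 0) ^ 2 + p (ℓ, 1) ^ 2 + p (ℓ, 2) ^ 2)) * p (ℓ, 2)]))) g ^ n)) z).1)) +
            ∑ i, ((((flip : Equiv.Perm (GaugeConfig d L (Matrix.specialUnitaryGroup (Fin 2) ℂ) × ((Edge d L × Fin 3) → ℝ))) *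
              leapfrog (mulDrift (fun p : (Edge d L × Fin 3) → ℝ => fun ℓ : Edge d L => gaussUnit (toLp 2
          ![Real.cos (c * Real.sqrt (p (ℓ, 0) ^ 2 + p (ℓ, 1) ^ 2 + p (ℓ, 2) ^ 2)),
            c * Real.sinc (c * Real.sqrt (p (ℓ, 0) ^ 2 + p (ℓ, 1) ^ 2 + p (ℓ, 2) ^ 2)) * p (ℓ, 0),
            c * Real.sinc (c * Real.sqrt (p (ℓ, 0) ^ 2 + p (ℓ, 1) ^ 2 + p (ℓ, 2) ^ 2)) * p (ℓ, 1),
            c * Real.sinc (c * Real.sqrt (p (ℓ, 0) ^ 2 + p (ℓ, 1) ^ 2 + p (ℓ, 2) ^ 2)) * p (ℓ, 2)]))) g ^ n)) z).2 i ^ 2 / 2) -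
          ((S (F z.1) - Real.log (J z.1)) + ∑ i, z.2 i ^ 2 / 2))
      (boltzmann ((Measure.pi fun _ : Edge d L => haarProbability (Matrix.specialUnitaryGroup (Fin 2) ℂ)).prod
            (volume : Measure ((Edge d L × Fin 3) → ℝ)))
          fun z : GaugeConfig d L (Matrix.specialUnitaryGroup (Fin 2) ℂ) × ((Edge d L × Fin 3) → ℝ) => (S (F z.1) - Real.log (J z.1)) + ∑ i, z.2 i ^ 2 / 2)) :
    0 ≤ ∫ z, (((S (F ((((flip : Equiv.Perm (GaugeConfig d L (Matrix.specialUnitaryGroup (Fin 2) ℂ) × ((Edge d L × Fin 3) → ℝ))) *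
              leapfrog (mulDrift (fun p : (Edge d L × Fin 3) → ℝ => fun ℓ : Edge d L => gaussUnit (toLp 2
          ![Real.cos (c * Real.sqrt (p (ℓ, 0) ^ 2 + p (ℓ, 1) ^ 2 + p (ℓ, 2) ^ 2)),
            c * Real.sinc (c * Real.sqrt (p (ℓ, 0) ^ 2 + p (ℓ, 1) ^ 2 + p (ℓ, 2) ^ 2)) * p (ℓ, 0),
            c * Real.sinc (c * Real.sqrt (p (ℓ, 0) ^ 2 + p (ℓ, 1) ^ 2 + p (ℓ, 2) ^ 2)) * p (ℓ, 1),
            c * Real.sinc (c * Real.sqrt (p (ℓ, 0) ^ 2 + p (ℓ, 1) ^ 2 + p (ℓ, 2) ^ 2)) * p (ℓ, 2)]))) g ^ n)) z).1) -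
            Real.log (J ((((flip : Equiv.Perm (GaugeConfig d L (Matrix.specialUnitaryGroup (Fin 2) ℂ) × ((Edge d L × Fin 3) → ℝ))) *
              leapfrog (mulDrift (fun p : (Edge d L × Fin 3) → ℝ => fun ℓ : Edge d L => gaussUnit (toLp 2
          ![Real.cos (c * Real.sqrt (p (ℓ, 0) ^ 2 + p (ℓ, 1) ^ 2 + p (ℓ, 2) ^ 2)),
            c * Real.sinc (c * Real.sqrt (p (ℓ, 0) ^ 2 + p (ℓ, 1) ^ 2 + p (ℓ, 2) ^ 2)) * p (ℓ, 0),
            c * Real.sinc (c * Real.sqrt (p (ℓ, 0) ^ 2 + p (ℓ, 1) ^ 2 + p (ℓ, 2) ^ 2)) * p (ℓ, 1),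
            c * Real.sinc (c * Real.sqrt (p (ℓ, 0) ^ 2 + p (ℓ, 1) ^ 2 + p (ℓ, 2) ^ 2)) * p (ℓ, 2)]))) g ^ n)) z).1)) +
            ∑ i, ((((flip : Equiv.Perm (GaugeConfig d L (Matrix.specialUnitaryGroup (Fin 2) ℂ) × ((Edge d L × Fin 3) → ℝ))) *
              leapfrog (mulDrift (fun p : (Edge d L × Fin 3) → ℝ => fun ℓ : Edge d L => gaussUnit (toLp 2
          ![Real.cos (c * Real.sqrt (p (ℓ, 0) ^ 2 + p (ℓ, 1) ^ 2 + p (ℓ, 2) ^ 2)),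
            c * Real.sinc (c * Real.sqrt (p (ℓ, 0) ^ 2 + p (ℓ, 1) ^ 2 + p (ℓ, 2) ^ 2)) * p (ℓ, 0),
            c * Real.sinc (c * Real.sqrt (p (ℓ, 0) ^ 2 + p (ℓ, 1) ^ 2 + p (ℓ, 2) ^ 2)) * p (ℓ, 1),
            c * Real.sinc (c * Real.sqrt (p (ℓ, 0) ^ 2 + p (ℓ, 1) ^ 2 + p (ℓ, 2) ^ 2)) * p (ℓ, 2)]))) g ^ n)) z).2 i ^ 2 / 2) -
          ((S (F z.1) - Real.log (J z.1)) + ∑ i, z.2 i ^ 2 / 2))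
      ∂(boltzmann ((Measure.pi fun _ : Edge d L => haarProbability (Matrix.specialUnitaryGroup (Fin 2) ℂ)).prod
            (volume : Measure ((Edge d L × Fin 3) → ℝ)))
          fun z : GaugeConfig d L (Matrix.specialUnitaryGroup (Fin 2) ℂ) × ((Edge d L × Fin 3) → ℝ) => (S (F z.1) - Real.log (J z.1)) + ∑ i, z.2 i ^ 2 / 2) :=
  gauge_fthmc_leapfrog_gaussian_deltaH_nonneg hJ hJm hF (measurable_su2Drift c) hg n hS hSi hδ

end SU2

end Summit.Ventures.LatticeQCDFlow.Exactness
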